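import Summits.FinalStateConjecture.FinalStateConjecture.Theses.PhaseMixingCapture
import Summits.FinalStateConjecture.FinalStateConjecture.Theses.SwallowTheDatum
import Literature.Geometry.Lorentzian.StabilityCauchy
import Literature.Geometry.Lorentzian.ModelData
import Literature.Geometry.Lorentzian.InitialDataPullback
import Literature.Geometry.Lorentzian.SmoothDataFamilyLocal

/-!
# Line `throat-is-the-junction` — skeleton for the crux `PhaseMixingCapture.WeakCosmicCensorshipMGHD`
# (item stmt-FinalStateConjecture-9952)

Planner seat `cruxplan-stmt-FinalStateConjecture-9952-throat-is-the-juncti`, round 1, 2026-08-16.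
Idea card `Cruxes/WeakCosmicCensorshipMGHD/Ideas/throat-is-the-junction.md` (ideator 2; all three
triagers PASS; merged with `throat-shadow-time-symmetric-shield` = cluster B "throat line", rated the
primary line by `TRIAGE-r1-2`/`-3`), sharpened by `TRIAGE-r1-{1,2,3}.md`; line card `Lines/throat-is-the-junction.md`.

## The line

The crux `W` reads only `J⁺` of far sheet-1 ray origins: Christodoulou-generically in the admissible
class, an MGHD exists and EVERY MGHD has complete `𝓘⁺` (sojourn form). Through every admissible `d`
we pass a smooth injective admissible family `F` whose members `F c`, `c ≠ 0`, are THROAT-SHIELDED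
(`IsThroatShielded`): outside a compact set the member IS the time-symmetric isotropic Schwarzschild
slice `((1 + M/2‖y‖)⁴ δ, 0)` on `{‖y‖ > R₁}`, `R₁ < M/2` — the physical end, the Einstein–Rosen
minimal throat `‖y‖ = M/2` and a collar of the second sheet — with `d` sitting in a bag of gold behind
the throat (`k ≡ 0` on the shield, DR-admissible in its own chart, no Boyer–Lindquist bending, no
spin, no Einstein evolution). CERTIFICATE (`stub_throatShieldedScri`, the load-bearing new content):
the static chart `ℝ × {‖y‖ > M/2}` (Kruskal region I) is an explicit vacuum Cauchy development of the
open-sheet sub-datum in which far rays are complete or bank sojourn `≥ r_entry − 2M → ∞` before the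
horizon (sharp `a = 0` ledger `|ṙ| ≤ E = √(1 − 2M/R_p) ≤ 1`; kit j009537 / j009699: 0 violations), so
the member is SCRI-SHIELDED (`IsScriShielded`: some co-compact sub-datum has SOME far-complete vacuum
development); TRANSFER (`stub_scriTransfer`, shared with cluster A): exterior ignorance (item 10053,
`SubdataDevelopmentsEmbed`) embeds that development in every MGHD and sojourn completeness rides along
the embedding; with MGHD existence (item 9937, `MGHDExists`) the crux follows by unfolding
`IsChristodoulouGeneric … 1`. ENGINE (`ThroatBurial`, proved here from three stubs + the junction
lemma exactly as route SwallowTheDatum's picked skeleton `receding-annulus-universal-collar` proves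
`ParametricKerrBurial`, triage r1-3 STAFFING FACT): NEVER MOVE THE DATUM — `stub_farGluing` (VERBATIM
the registered stub of crux 10052: Mao–Oh–Tao obstruction-free re-gluing of `d`'s own far annulus onto
an exact isotropic Schwarzschild(`m_R ≥ ηR`) end, smooth in `R`) + `stub_bagDatum` (ONE `d`-free
admissible time-symmetric BAG-OF-GOLD datum `𝔅` on `ℝ³`: Corvino core | exact Schwarzschild(`μ`)
floor annulus `{1 < ‖z‖ < 2}` | bag | exact collar–throat–end, shield chart beyond radius `2`;
Beig–Ó Murchadha critical bag with two Green's-function poles + Corvino's ORIGINAL gluing, or the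
sibling crux 10055's `PlugData` + one floor insertion) + `stub_splice` (dilate `𝔅` by `λ = m_R/μ`,
transport along the end chart, patch on the common exact Schwarzschild(`m_R`) annulus, breathe the
core) + `junction` (PROVED: `F c := S (R⋆ + 1 + ‖c‖⁻², arctan(c₀)/2)`, smooth at `c = 0` by local
exhaustion, injective by a marker read at a fixed interior point — no mass bookkeeping, one bag for
both signs of `c`, no large-`|c|` regime, so Disproof §7's squashing is not even needed).

Composition (kernel-checked, no `sorry` of its own; hypotheses = the five stub signatures BY NAME +
the two registered route items 9937/10053 BY NAME; conclusion = the crux decl BY NAME):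
`WeakCosmicCensorshipMGHD_of : MGHDExists → SubdataDevelopmentsEmbed → Sig.stub_scriTransfer →
Sig.stub_throatShieldedScri → Sig.stub_farGluing → Sig.stub_bagDatum → Sig.stub_splice →
WeakCosmicCensorshipMGHD`.  HARDEST stub: `stub_bagDatum` (XL, d-free strong-field existence);
LOAD-BEARING for the idea: `stub_throatShieldedScri` (L).

## Disproof used (`Cruxes/WeakCosmicCensorshipMGHD/Disproof.lean`, cdisprove, verdict RESISTS; read 2026-08-16)

* No `_false_without_<H>` theorem exists on the positive side; the ANNOUNCED mutation (drop the
  vacuum-constraint clause of admissibility ⇒ `_false_without_`) is honoured: every member is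
  admissible — `stub_farGluing`/`stub_splice` conclude `∈ admissibleVacuumData X`, `stub_bagDatum`
  delivers `𝔅 ∈ admissibleVacuumData E3`, and `F 0 = d` uses `hd` itself.
* §1 `wcc_iff`/`isChristodoulouGeneric_mono`: the composition unfolds the same `HasCodimAtLeastIn`;
  §5 here re-proves `FinalStateConjecture → W` (necessity; no transfer weakens the crux).
* §2 `exists_isMaximal_complete_of_wcc` (MGHD theory is load-bearing, no bookkeeping proof):
  displayed — `MGHDExists` (9937) and `SubdataDevelopmentsEmbed` (10053) are hypotheses BY NAME.
* §3 `mghd_unique_cauchy` PROVED / `CompleteNullInfinityInvariant` UNPROVED: not owed — the transfer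
  is applied to EVERY maximal `𝒟` separately.
* §4(b) `[T2Space X]` load-bearing (`Negative/LoadBearing.lean`, landed; not yet built on the farm, so
  not importable here — its one-line content is re-proved below as `negative_check_t2`): kept in every def.
* §4(c)+§8 `IsMaximal` load-bearing — `Negative/TruncatedMinkowski.lean` (landed,
  `exists_vacuumCauchyDevelopment_trivialData_not_complete`; unbuilt on the farm at the time of writing,
  cited by name): honoured — `IsScriShielded` asks for SOME far-complete development of a
  sub-datum and completeness is moved only along the embedding `χ` that 10053 grants for MAXIMAL
  targets; no stub asserts completeness of an arbitrary development.
* §5 `minkowski_hasCompleteNullInfinity` (`Negative/LoadBearing.lean`): the certificate's region-I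
  argument is its Schwarzschild analogue (explicit null geodesics + uniqueness) plus the sojourn bank.
* §7 `isChristodoulouGeneric_iff_local` (local families suffice): available but unused — the junction
  lemma already yields a GLOBAL smooth injective family.
* §9 `BurialWitnesses` / `Negative/GenericityComplement.lean`: this line IS a burial (declared
  honestly on the card and below): it lives off the topology-free typing of `IsSmoothDataFamily`;
  a re-typing with weighted continuity at `c = 0` kills `ThroatBurial` (kill criterion), after which
  `stub_scriTransfer` + `stub_throatShieldedScri` survive as infrastructure.
* Sibling standing files honoured: 10052 Disproof PMT note (no datum inside an exactly FLAT collar —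
  the floor annulus is Schwarzschild(`μ`), `μ > 0`, and `d`'s own end is discarded with `ΔE > |ΔP|`);
  10055 Disproof §7 (`Kerr.not_isStronglyAsymptoticallyFlatDR_data`: Kerr–Schild ends fail DR — the
  shield here is isotropic, `k ≡ 0`); 10054 TRIAGE-r1-2 T1 (sharp ledger true at `a = 0` only — used
  at `a = 0` only); this crux's TRIAGE A1/A2/F1 (all-origin completeness of a proper sub-development is
  always false — the certificate is FAR-origin with the exempted compact `K ⊆ X`, and the shield
  predicate carries co-compact far zones so the junk instance `X = open sheet, Φ = id` is excluded).
* `ledger negatives --problem FinalStateConjecture`: 0 refuted statements (2026-08-16).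
-/

set_option linter.dupNamespace false
set_option maxSynthPendingDepth 3

noncomputable section

namespace Summit.FinalStateConjecture.FinalStateConjecture.Cruxes.WeakCosmicCensorshipMGHD.ThroatIsTheJunction

open scoped Manifold ContDiff Topology
open Bundle Set Filter Function Literature.Geometry.Lorentzian
open Summit.FinalStateConjecture.FinalStateConjecture.Theses.PhaseMixingCapture (WeakCosmicCensorshipMGHD)
open Summit.FinalStateConjecture.FinalStateConjecture.Theses.SwallowTheDatum
  (SubdataDevelopmentsEmbed MGHDExists)

/-! ## §0 Vocabulary (all over existing tree declarations) -/

section ShieldVocabulary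

/-- The second-sheet junction region `{y | R₁ < ‖y‖}` of the isotropic (doubled) Schwarzschild
slice: for `0 < R₁ < M/2` it contains sheet 1 (`‖y‖ > M/2`, the physical end), the minimal
Einstein–Rosen throat `‖y‖ = M/2` and the collar `R₁ < ‖y‖ < M/2` of sheet 2 (MTW 1973, §31.7,
(31.22); Kruskal 1960). -/
def throatRegion (R₁ : ℝ) : TopologicalSpace.Opens E3 :=
  ⟨{y | R₁ < ‖y‖}, isOpen_lt continuous_const continuous_norm⟩

theorem mem_throatRegion {R₁ : ℝ} {y : E3} : y ∈ throatRegion R₁ ↔ R₁ < ‖y‖ := Iff.rfl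

theorem zero_notMem_throatRegion {R₁ : ℝ} (hR : 0 < R₁) :
    (0 : E3) ∉ (throatRegion R₁ : Set E3) := by
  simp [throatRegion, hR.le, not_lt.mpr]

/-- `D` on `X` is **throat-shielded** (the card's object, with ONE sharpening): there are a mass
`M > 0`, a junction radius `0 < R₁ < M/2` and an open embedding `Φ : {‖y‖ > R₁} → X` with injective
differentials such that
* the FAR ZONES `Φ{‖y‖ > R'}` of the shield are co-compact in `X` for every `R'` (for `R' ≤ R₁` this
  is "`(range Φ)ᶜ` compact" as on the card; for larger `R'` it says the shield's end IS the end of `X`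
  — the sharpening: it is what the constructions deliver for free, it hands the certificate its
  exempted compact set without a Hopf–Rinow / end-cofinality argument, and it excludes the junk
  instance `X = open sheet, Φ = id` of TRIAGE-r1-3 A2), and
* the pulled-back datum IS the time-symmetric isotropic Schwarzschild slice
  `Schwarzschild.conformalData M = ((1 + M/2‖y‖)⁴ δ, 0)` on `{‖y‖ > R₁}` — exact on the physical end,
  ACROSS the minimal throat `‖y‖ = M/2` and on the sheet-2 collar `R₁ < ‖y‖ < M/2`.
`k ≡ 0` and `(1 + M/2r)⁴ = 1 + 2M/r + O(r⁻²)`: the end is DR-admissible in this very chart (contrast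
`Kerr.not_isStronglyAsymptoticallyFlatDR_data` for Kerr–Schild ends, 10055 Disproof §7). -/
def IsThroatShielded (X : Type) [TopologicalSpace X] [ChartedSpace E3 X] [IsManifold (𝓡 3) ∞ X]
    (D : InitialDataSet (𝓡 3) X) : Prop :=
  ∃ (M R₁ : ℝ) (hM : 0 < M) (hR : 0 < R₁), R₁ < M / 2 ∧
    ∃ (Φ : throatRegion R₁ → X) (hΦ : ContMDiff 𝓘(ℝ, E3) (𝓡 3) (∞ + 1) Φ)
      (hΦ' : ∀ u, Function.Injective (mfderiv 𝓘(ℝ, E3) (𝓡 3) Φ u)),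
      Topology.IsOpenEmbedding Φ ∧
      (∀ R' : ℝ, IsCompact (Φ '' {y : throatRegion R₁ | R' < ‖(y : E3)‖})ᶜ) ∧
      D.comap Φ hΦ hΦ' =
        Schwarzschild.conformalData (M := M) (throatRegion R₁) hM.le (zero_notMem_throatRegion hR)

/-- The throat shield for a datum on `E3` with the shield LOCATED: the shielding chart ranges in
`{ρ < ‖z‖}` (so that a matching annulus inside `{‖z‖ ≤ ρ}` never meets the exact region; the bag
and the floor sit inside `{‖z‖ ≤ ρ}` or between). Otherwise verbatim `IsThroatShielded E3 C`. -/
def IsThroatShieldedAway (ρ : ℝ) (C : InitialDataSet (𝓡 3) E3) : Prop :=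
  ∃ (M R₁ : ℝ) (hM : 0 < M) (hR : 0 < R₁), R₁ < M / 2 ∧
    ∃ (Φ : throatRegion R₁ → E3) (hΦ : ContMDiff 𝓘(ℝ, E3) (𝓡 3) (∞ + 1) Φ)
      (hΦ' : ∀ u, Function.Injective (mfderiv 𝓘(ℝ, E3) (𝓡 3) Φ u)),
      (∀ y : throatRegion R₁, ρ < ‖Φ y‖) ∧
      Topology.IsOpenEmbedding Φ ∧
      (∀ R' : ℝ, IsCompact (Φ '' {y : throatRegion R₁ | R' < ‖(y : E3)‖})ᶜ) ∧
      C.comap Φ hΦ hΦ' =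
        Schwarzschild.conformalData (M := M) (throatRegion R₁) hM.le (zero_notMem_throatRegion hR)

/-- A located throat shield is a throat shield (projection; bookkeeping sanity). -/
theorem isThroatShielded_of_away {ρ : ℝ} {C : InitialDataSet (𝓡 3) E3}
    (h : IsThroatShieldedAway ρ C) : IsThroatShielded E3 C := by
  obtain ⟨M, R₁, hM, hR, hlt, Φ, hΦ, hΦ', -, hopen, hfar, hexact⟩ := h
  exact ⟨M, R₁, hM, hR, hlt, Φ, hΦ, hΦ', hopen, hfar, hexact⟩

/-- `D` on `X` is **scri-shielded** — the weakest shield the crux accepts (shared with cluster A,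
ideator 2's `IsScriShielded` verbatim): some exterior sub-datum `Φ^* D` (over a smooth open embedding
`Φ : N → X` with injective differentials, `N` connected) possesses SOME vacuum Cauchy development `𝒦`
with complete future null infinity in the far-origin sojourn form from origins `A ⊆ N` which cover `X`
off a compact set `K`. (For throat-shielded data: `N` = the open sheet `{‖y‖ > M/2}`, `𝒦` = the static
chart = Kruskal region I, `K` = the complement of a far zone of the shield.) An `∃`-over-developments
statement on purpose: by `Negative/TruncatedMinkowski` a `∀`-form would be false already at the
trivial datum (`Negative.exists_vacuumCauchyDevelopment_trivialData_not_complete`). -/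
def IsScriShielded (X : Type) [TopologicalSpace X] [ChartedSpace E3 X] [IsManifold (𝓡 3) ∞ X]
    [T2Space X] [SecondCountableTopology X] [ConnectedSpace X] (D : InitialDataSet (𝓡 3) X) :
    Prop :=
  ∃ (N : Type) (_ : TopologicalSpace N) (_ : ChartedSpace E3 N) (_ : IsManifold (𝓡 3) ∞ N)
    (_ : ConnectedSpace N) (Φ : N → X) (hΦ : ContMDiff (𝓡 3) (𝓡 3) (∞ + 1) Φ)
    (hΦ' : ∀ u, Function.Injective (mfderiv (𝓡 3) (𝓡 3) Φ u)),
    Topology.IsOpenEmbedding Φ ∧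
    ∃ (𝒦 : VacuumCauchyDevelopment (D.comap Φ hΦ hΦ')) (A : Set N) (K : Set X),
      IsCompact K ∧ Kᶜ ⊆ Φ '' A ∧ 𝒦.toDataEmbedding.HasCompleteFutureNullInfinityFrom A

/-- **ThroatBurial** (the engine's output, an intermediate notion PROVED below from the three engine
stubs + the junction lemma, `throatBurial_of`): through every admissible datum passes a jointly smooth,
injective, admissible one-parameter family whose members off `c = 0` are throat-shielded. -/
def ThroatBurial : Prop :=
  ∀ (X : Type) [TopologicalSpace X] [ChartedSpace E3 X] [IsManifold (𝓡 3) ∞ X]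
    [T2Space X] [SecondCountableTopology X] [ConnectedSpace X],
    ∀ d ∈ admissibleVacuumData X, ∃ F : EuclideanSpace ℝ (Fin 1) → InitialDataSet (𝓡 3) X,
      InitialDataSet.IsSmoothDataFamily 1 F ∧ F 0 = d ∧ Function.Injective F ∧
      (∀ c, F c ∈ admissibleVacuumData X) ∧ ∀ c ≠ 0, IsThroatShielded X (F c)

end ShieldVocabulary

/-! ### Engine vocabulary — VERBATIM from `Cruxes/ParametricKerrBurial/Lines/receding-annulus-universal-collar.lean`
(crux 10052's picked skeleton), so that `Sig.stub_farGluing` below is character-for-character the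
statement registered there and ONE proof serves both cruxes. -/

section Vocabulary

variable {X : Type} [TopologicalSpace X] [ChartedSpace E3 X] [IsManifold (𝓡 3) ∞ X]

/-- Joint smoothness, on a set `s ⊆ P × X`, of the two section maps `(p, x) ↦ h_{S p}(x)` and
`(p, x) ↦ k_{S p}(x)` of a family of initial data `S : P → InitialDataSet (𝓡 3) X` indexed by a
manifold `P` (model `IP`).  For `P = ℝ¹`, `s = univ` this is verbatim `InitialDataSet.IsSmoothDataFamily 1 S`
(Genericity.lean); the partial version is what gluing-by-IFT delivers (smooth on an OPEN parameter set). -/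
def SmoothSectionsOn {P : Type} [TopologicalSpace P] {EP : Type} [NormedAddCommGroup EP]
    [NormedSpace ℝ EP] {HP : Type} [TopologicalSpace HP] (IP : ModelWithCorners ℝ EP HP)
    [ChartedSpace HP P] (S : P → InitialDataSet (𝓡 3) X) (s : Set (P × X)) : Prop :=
  ContMDiffOn (IP.prod (𝓡 3)) ((𝓡 3).prod 𝓘(ℝ, E3 →L[ℝ] E3 →L[ℝ] ℝ)) ∞
      (fun p : P × X ↦
        TotalSpace.mk' (F := E3 →L[ℝ] E3 →L[ℝ] ℝ)
          (E := fun x : X ↦ TangentSpace (𝓡 3) x →L[ℝ] TangentSpace (𝓡 3) x →L[ℝ] ℝ) p.2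
          ((S p.1).h.inner p.2)) s ∧
    ContMDiffOn (IP.prod (𝓡 3)) ((𝓡 3).prod 𝓘(ℝ, E3 →L[ℝ] E3 →L[ℝ] ℝ)) ∞
      (fun p : P × X ↦
        TotalSpace.mk' (F := E3 →L[ℝ] E3 →L[ℝ] ℝ)
          (E := fun x : X ↦ TangentSpace (𝓡 3) x →L[ℝ] TangentSpace (𝓡 3) x →L[ℝ] ℝ) p.2
          ((S p.1).k p.2)) s

/-- Two data `D`, `D'` on `X` have the same sections (metric and second fundamental form) at `x`. -/
def AgreeAt (D D' : InitialDataSet (𝓡 3) X) (x : X) : Prop :=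
  D.h.inner x = D'.h.inner x ∧ D.k x = D'.k x

/-- In the chart of the end `e`, the datum `D` is EXACTLY the time-symmetric isotropic Schwarzschild
datum of mass `m` beyond chart radius `ρ`: `h = (1 + m/(2‖x‖))⁴ δ`, `k = 0` for `ρ < ‖x‖`
(chart components `AFEnd.hCoeff`/`AFEnd.kCoeff`, AsymptoticFlatness.lean).  Such an end is DR-flat
with mass `m` (`(1 + m/2r)⁴ = 1 + 2m/r + O(r⁻²)`). -/
def IsExactSchwarzschildBeyond (e : AFEnd X) (D : InitialDataSet (𝓡 3) X) (m ρ : ℝ) : Prop :=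
  ∀ x : E3, ρ < ‖x‖ →
    AFEnd.hCoeff e D x = (1 + m / (2 * ‖x‖)) ^ 4 • (innerSL ℝ : E3 →L[ℝ] E3 →L[ℝ] ℝ) ∧
      AFEnd.kCoeff e D x = 0

/-- On `E3` itself (tangent spaces `= E3`): `C` is exactly isotropic Schwarzschild(`μ`), `k = 0`, on
the coordinate annulus `{1 < ‖y‖ < 2}` — the matching annulus of the universal collar. -/
def IsSchwarzschildAnnulus (C : InitialDataSet (𝓡 3) E3) (μ : ℝ) : Prop :=
  ∀ y : E3, 1 < ‖y‖ → ‖y‖ < 2 →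
    C.h.inner y = (1 + μ / (2 * ‖y‖)) ^ 4 • (innerSL ℝ : E3 →L[ℝ] E3 →L[ℝ] ℝ) ∧ C.k y = 0


end Vocabulary

/-! ## §1 The five stub STATEMENTS

Each stub statement is the `Prop` `Sig.stub_<name>`; the registered obligation is
`theorem stub_<name> : Sig.stub_<name> := by sorry` (§2), and `WeakCosmicCensorshipMGHD_of` (§4) takes
the five signatures — plus the registered route items `MGHDExists` (9937) and `SubdataDevelopmentsEmbed`
(10053) — as hypotheses BY NAME (skeleton audit: hypothesis heads = stub names / tagged items). -/

/-- **Stub T — `stub_scriTransfer` (far-origin sojourn completeness rides along an embedded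
sub-development; size M–L; pure causal/ODE theory over the prelude; SHARED with cluster A —
ideator 2's `ScriTransfer` verbatim, = ideator 3's `ScriAscends` up to where `B₁` lives; the sibling line
`Lines/scri-transfer-third-of-burial.lean` registers `stub_scriTransfer` with the IDENTICAL `Sig` text, so ONE
proof closes it for both lines of this crux).**
Let `𝒟` be a Cauchy development of `D` on `X`, `Φ : N → X` a smooth open embedding with injective
differentials, `𝒮` ANY data embedding of the pulled-back data `Φ^* D` which embeds into `𝒟` OVER
`Φ` by a smooth, time-orientation preserving, isometric open embedding `χ` with `χ ∘ ι' = ι ∘ Φ`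
(exactly the conclusion shape of `SubdataDevelopmentsEmbed`). If `𝒮` has complete `𝓘⁺` in the
sojourn form AS SEEN FROM origins `A ⊆ N`, and `Kᶜ ⊆ Φ(A)` for a compact `K ⊆ X`, then `𝒟` has
complete `𝓘⁺` from all origins (`Summit.FinalStateConjecture.HasCompleteNullInfinity`).
Why true (TRIAGE-r1-2 F2, r1-1 (d), r1-3 A1, checked on paper by all three): a maximal normalised
null ray `γ` of `𝒟` from `ι(Φ q)` restricts, on the connected component of `γ⁻¹(χ 𝒮)` containing
`0`, to `χ ∘ γ'` with `γ'` a MAXIMAL geodesic of `𝒮` from `ι' q` (Hausdorffness, openness of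
`χ 𝒮`, uniqueness of geodesics); it is normalised because `dχ(ν' q) = ν(Φ q)`
(`Theorems/SwallowTheDatumSubdataDevelopmentsEmbedRigidity.mfderiv_normal_rel`, LANDED) and `χ` is
isometric; then `¬BddAbove dom' → ¬BddAbove dom`, and
`sojournTime γ' dom' (J⁺(ι' B₀')) ≤ sojournTime γ dom (J⁺(ι (Φ '' B₀')))` by
`χ(J⁺_{𝒮}(ι' B₀')) ⊆ J⁺_{𝒟}(ι Φ B₀')` (`χ` maps causal curves to causal curves) and
`sojournTime_mono`/`sojournTime_mono_left` (NullInfinity.lean); take `B₀ := Φ '' B₀'`,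
`B₁ := K ∪ Φ '' B₁'`. The ALL-origin variant (ideator 1's `CensorshipDescends`) is vacuous for every
proper sub-datum (edge rays, TRIAGE F1/A1) — this far-origin form is the usable one.
Why it might fail: only through a typing defect of `IsNormalisedNullRayFrom`/`sojournTime` (none
found by the disprover's junk hunt: rays are maximal geodesics with `g(γ̇, ν) = −1`).
Leans on: `CauchyDevelopment`, `DataEmbedding.HasCompleteFutureNullInfinityFrom` (StabilityCauchy),
`InitialDataSet.comap`, `LorentzianMetric.IsNormalisedNullRayFrom`, `sojournTime_mono(_left)`,
`mfderiv_normal_rel`, Mathlib `IsOpenEmbedding`. [cite: Christodoulou1999, pp. A26–A27]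
[cite: arXiv08110354, §2.6.2] [cite: HawkingEllis1973CUP, Prop. 6.6.3, §7.5–7.6]
[cite: ChoquetBruhatGeroch1969CMP] -/
def Sig.stub_scriTransfer : Prop :=
  ∀ (X : Type) [TopologicalSpace X] [ChartedSpace E3 X] [IsManifold (𝓡 3) ∞ X]
    [T2Space X] [SecondCountableTopology X] [ConnectedSpace X]
    (D : InitialDataSet (𝓡 3) X) (𝒟 : CauchyDevelopment D)
    (N : Type) [TopologicalSpace N] [ChartedSpace E3 N] [IsManifold (𝓡 3) ∞ N] [ConnectedSpace N]
    (Φ : N → X) (hΦ : ContMDiff (𝓡 3) (𝓡 3) (∞ + 1) Φ)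
    (hΦ' : ∀ u, Function.Injective (mfderiv (𝓡 3) (𝓡 3) Φ u)),
    Topology.IsOpenEmbedding Φ →
    ∀ (𝒮 : DataEmbedding (D.comap Φ hΦ hΦ')) (χ : 𝒮.carrier → 𝒟.carrier),
      ContMDiff (𝓡 4) (𝓡 4) ∞ χ → Topology.IsOpenEmbedding χ →
      𝒮.metric.IsIsometricImmersion 𝒟.metric.toPseudoRiemannianMetric χ →
      𝒮.timeOrientation.PreservesTimeOrientation χ 𝒟.timeOrientation →
      χ ∘ 𝒮.embed = 𝒟.embed ∘ Φ →
      ∀ (A : Set N) (K : Set X), IsCompact K → Kᶜ ⊆ Φ '' A →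
        𝒮.HasCompleteFutureNullInfinityFrom A →
        Summit.FinalStateConjecture.HasCompleteNullInfinity 𝒟

/-- **Stub S — `stub_throatShieldedScri` (THE CERTIFICATE; size L; the load-bearing new content of
this line): an admissible throat-shielded datum is scri-shielded.**
Proof plan (TRIAGE-r1-3 sharpening: certify from the OPEN SHEET, no Kruskal object needed).
Given `IsThroatShielded X D` with `(M, R₁, Φ)`, take `N :=` the open sheet
`{y | M/2 < ‖y‖}` (`Schwarzschild.isotropicExterior M = exteriorRegion (M/2)`, connected:
`isConnected_isotropicExterior`), `Φ_N := Φ ∘ incl`, so `Φ_N^* D = conformalData M` on the sheet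
(`comap` along the inclusion; `conformalData_h_inner/_k`). The certifying development `𝒦`: carrier
the static chart `ℝ × N ⊂ E4` (an `Opens E4`), metric `g = −V² dt² + ψ⁴ δ`,
`V = (1 − M/2ρ)/(1 + M/2ρ)`, `ψ = 1 + M/2ρ` — isotropic static Schwarzschild = Kruskal region I
`{X > |T|}` — time orientation `∂_t`, embedding `ι y = (0, y)`, normal `ν = V⁻¹∂_t`, induced data
`(ψ⁴δ, 0)` ✓; VACUUM: Ricci-flatness of static isotropic Schwarzschild (a finite symbolic identity;
or transport `Kerr.isRicciFlat M 0` — whose `a = 0` case is worked out in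
`SchwarzschildKerrSchild{Components,Koszul,RicciFlat}.lean` — along the explicit static↔Kerr–Schild
diffeomorphism of region I); CAUCHY: `t` is a time function and future causal curves obey
`|dρ_*/dt| ≤ 1` in the tortoise-type coordinate, so an inextendible causal curve has `t`-range `ℝ`
and meets `{t = 0}` exactly once (the horizon and infinity sit at `t = ±∞`; Kruskal: past causal
curves from `(T₀, X₀ > |T₀|)` meet `T = 0` inside `[X₀ − |T₀|, X₀ + |T₀|] ⊂ (0, ∞)`), argued like
`isCauchyHypersurface_futureCut` of `Negative/TruncatedMinkowski`. EXEMPTED SET: for any `R'' > M/2`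
put `K := (Φ '' {R'' < ‖y‖})ᶜ` — compact by the far-zone clause of `IsThroatShielded` (this is where
the junk instance `X = N, Φ = id` of TRIAGE A2 is excluded; no completeness/Hopf–Rinow needed) — and
`A := {y ∈ N | R'' < ‖y‖}`, so `Kᶜ = Φ_N '' A`. FAR SOJOURN in region I from origins `‖y‖ > R(s)`
(`B₀ :=` the compact annulus `{R₀ ≤ ‖y‖ ≤ R₀ + 1} ⊆ N`, `B₁(s) := {R'' ≤ ‖y‖ ≤ 2s + 4M + 2M log s + R₀}`
compact in `N` because bounded away from the throat): a normalised future null geodesic from areal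
radius `R_p` has conserved `E = −g(γ̇, ∂_t) = V(R_p) = √(1 − 2M/R_p) ≤ 1` and `L`, with
`ṙ² = E² − (1 − 2M/r)L²/r² ≤ E²` on `r > 2M` (the SHARP `a = 0` ledger; false for `a ≠ 0`, 10054
TRIAGE-r1-2 T1, not needed here); outgoing/bouncing rays and photon-sphere asymptotes stay in region I
forever and are affinely complete there (`¬ BddAbove dom`); an infalling ray has
`du/dλ = (E + |ṙ|)/(1 − 2M/r) ≥ 2|ṙ|`, enters `J⁺(ι B₀) ⊇ {t ≥ 0, u ≥ −r_*(R₀ + 1)}` at radius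
`r_e ≥ (R_p + R₀)/2 − M log((R_p − 2M)/(R₀ − 2M))` and then banks affine time `≥ (r_e − 2M)/E ≥
r_e − 2M → ∞` before it can reach the horizon, i.e. before leaving `𝒦` (verified numerically:
kit j009537, 72 rays, 0 violations, bound sharp to `0.02M` at `R_p = 1600M`; j009699 full scan).
Why it might fail: only inside the formalisation (an explicit `VacuumCauchyDevelopment` over an
`Opens E4` with its Cauchy-surface proof is Theorems-size; Schwarzschild Ricci-flatness in isotropic
form is not yet a tree theorem) — the mathematics is classical (Kruskal 1960; O'Neill 1983, Ch. 13).
Leans on: `IsThroatShielded`, `IsScriShielded`, `Schwarzschild.{conformalData, isotropicExterior,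
conformalFactor, timeSymmetricExteriorData}`, `VacuumCauchyDevelopment`, `Opens`-spacetime toolkit
(`OpensCausality`, `OpensChartGeodesic(ODE)`, as used by `Negative/TruncatedMinkowski`),
`DataEmbedding.HasCompleteFutureNullInfinityFrom`, `sojournTime_le_volume`/`_mono`, geodesic
uniqueness (`GeodesicMaximal`, `GeodesicOneSidedUniqueness`). [cite: Kruskal1960]
[cite: ONeill1983, Ch. 13] [cite: MisnerThorneWheeler1973, §31.7, (31.22)] [cite: Wald1984, §6.4]
[cite: HawkingEllis1973CUP, Prop. 6.6.3] [cite: arXiv08110354, §2.6.2, §5.1] -/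
def Sig.stub_throatShieldedScri : Prop :=
  ∀ (X : Type) [TopologicalSpace X] [ChartedSpace E3 X] [IsManifold (𝓡 3) ∞ X]
    [T2Space X] [SecondCountableTopology X] [ConnectedSpace X] (D : InitialDataSet (𝓡 3) X),
    D ∈ admissibleVacuumData X → IsThroatShielded X D → IsScriShielded X D

/-- **Stub A — `stub_farGluing` (the `d`-side: receding obstruction-free gluing onto a GROWING exact
Schwarzschild seed, smooth in the radius; size XL as a formalisation, "printed modulo a routine
upgrade" mathematically). VERBATIM the registered stub `stub_farGluing` of crux 10052's picked line
`receding-annulus-universal-collar` (same `Sig` text over the same vocabulary) — ONE proof serves both.**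
For every admissible `d` on `X` there are a rate `η > 0`, a SOLE asymptotically flat end `e` of `X`, a
threshold `R⋆ > e.R`, a smooth seed-mass function `m` with `m R ≥ η R` and a RADIUS-indexed family
`G : ℝ → InitialDataSet (𝓡 3) X`, jointly smooth in `(R, x)` on `{R⋆ < R} × X`, with, for every
`R > R⋆`: `G R` admissible; `G R = d` (same sections) off the far region `e.far R`; and in the chart
of `e` the datum `G R` is EXACTLY time-symmetric isotropic Schwarzschild of mass `m R` beyond chart
radius `32 R`.
Why plausibly true: Mao–Oh–Tao arXiv:2308.13031 Thm 1.7 (p. 6) at unit scale after `x ↦ R x` (their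
§5.6 proof of Thm 1.10, p. 7), in = `d`'s far field (the DR class `o₂(r⁻¹)/o₁(r⁻²)` is `α = 1`,
`s = 2` flat in the sense of their Def. 1.5, `k = o(r⁻²)` kills `P`), out = the isotropic
Schwarzschild(`η`) slice: the hypotheses `ΔE > |ΔP|`, `ΔE < ε_o²`, `|ΔC|+|ΔJ| < μ_oΔE`,
`‖in‖²+‖out‖² < μ_oΔE` hold iff `η < min(ε_o², μ_o/c)` and `R ≥ R₀(d, η)` (verified against the
printed statement by the 10052 triagers and re-read for this crux, TRIAGE-r1-1 (g)). Persistence of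
regularity (Rem. 1.9) gives `C^∞` members; constraints, completeness and the DR end are immediate.
Why it might fail / the unprinted atom (shared with every MOT engine of the pool, flagged by all three
triagers of THIS crux): Rem. 1.9 prints only LOCAL LIPSCHITZ dependence of the glued data on
`(in, out)`; joint `C^∞` in `(R, x)` needs the smooth IFT on a FIXED scheme (MOT §3 Picard iteration
with explicit Bogovskiĭ-type solution operators + §5 finite-dimensional charge selection, discrete
choices frozen on the whole parameter range) applied to the smooth input curve `R ↦ d(R·)`.
Leans on: `admissibleVacuumData`, `AFEnd.{far, IsSoleEnd, hCoeff, kCoeff, IsStronglyAsymptoticallyFlatDR}`,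
`InitialDataSet.IsVacuumConstraintSolution/IsComplete`. [cite: MaoOhTao2023, Thm 1.7, Thm 1.10, Def 1.5, Rem 1.9, Rem 1.11]
[cite: Bartnik1986, §1] [cite: DafermosRodnianski2013, App. B.2.3] -/
def Sig.stub_farGluing : Prop :=
  ∀ (X : Type) [TopologicalSpace X] [ChartedSpace E3 X] [IsManifold (𝓡 3) ∞ X]
    [T2Space X] [SecondCountableTopology X] [ConnectedSpace X],
    ∀ d ∈ admissibleVacuumData X,
      ∃ (η : ℝ) (e : AFEnd X) (Rstar : ℝ) (m : ℝ → ℝ) (G : ℝ → InitialDataSet (𝓡 3) X),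
        0 < η ∧ e.IsSoleEnd ∧ e.R < Rstar ∧ ContDiff ℝ ∞ m ∧
        SmoothSectionsOn 𝓘(ℝ, ℝ) G {p : ℝ × X | Rstar < p.1} ∧
        ∀ R : ℝ, Rstar < R →
          G R ∈ admissibleVacuumData X ∧
          (∀ x ∉ e.far R, AgreeAt (G R) d x) ∧
          η * R ≤ m R ∧ IsExactSchwarzschildBeyond e (G R) (m R) (32 * R)

/-- **Stub B — `stub_bagDatum` (the UNIVERSAL BAG OF GOLD: one `d`-free admissible datum on `ℝ³`;
size XL; HARDEST — the entire strong-field content of the line, and the anti-vacuity of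
`IsThroatShielded ∧ admissible` = the card's cheapest falsifier (1)).** For every `μ₀ > 0` there are
`0 < μ ≤ μ₀` and ONE admissible vacuum datum `𝔅` on `E3` (smooth, complete, vacuum constraints, one
sole DR-asymptotically-flat end) which is EXACTLY the time-symmetric isotropic Schwarzschild(`μ`)
datum on the FLOOR ANNULUS `{1 < ‖z‖ < 2}` (weak field, areal radius increasing INTO the bag) and is
throat-shielded with the shielding chart ranging in `{2 < ‖z‖}` (`IsThroatShieldedAway 2`): radially,
`core | floor annulus | bag (one maximum of the areal radius) | exact sheet-2 collar | minimal throat |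
exact physical end`. Only `{1 < ‖z‖}` is used downstream (the core is discarded by the splice).
Why plausibly true — two engines. (E-BOM, primary, entirely time-symmetric = scalar-flat Riemannian
geometry, every step printed) Beig–Ó Murchadha 1991: a smooth path `ĝ_s` of Yamabe-positive metrics
on `S³`, flat on balls around two points `Λ, x₀`, with `λ₁(L_{ĝ_s}) ↓ 0`; the conformal-Laplacian
Green's functions give the EXACT superposition `G = G_s(Λ, ·) + μ' G_s(x₀, ·)` (`L_{ĝ_s} G = 0` off the
poles — the equation is LINEAR), `g = G⁴ ĝ_s` scalar-flat, complete, two-ended; near `Λ`,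
`G = c/|x| + A + H(x)` with `H` harmonic, `H(0) = 0`, and `A = A(s) → ∞` along the path, so the
heavy throat `|x| = c/A` is tiny against the flat ball `B_{r₀}(Λ)`; on the annulus
`Γ = {R < |x| < 2R}`, `c/A ≪ R ≪ √(c r₀/A)` (window nonempty once `A r₀ ≫ c`, TRIAGE-r1-3), the
metric is weak-field Schwarzschild(`2c/A`) up to relative error `|H|/A ≲ R/r₀`, and Corvino's
ORIGINAL scalar-flat gluing (flat cokernel `span{1, xⁱ}` absorbed by the 4-parameter exact family
`(c_m/|x − ξ| + A')⁴δ` through the mass/centre fluxes — non-degenerate on any enclosing sphere,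
orientation immaterial, TRIAGE-r1-2 and r1-3) makes `{|x| < R}` EXACTLY isotropic Schwarzschild: the
physical end, the throat and a long sheet-2 collar (`R₁ < M/2` for free). At the light pole the same
step on `Γ₂ = {R₂ < |w| < 2R₂}` makes `{|w| < R₂}` exactly Schwarzschild(`2μ'/A''`); cut it at
`|w| = R₂/4` (bag side of the light throat, weak field) and fill the hole with a CORVINO CORE (a
scalar-flat metric on `ℝ³` exactly Schwarzschild outside a compact set, Corvino 2000, homothetically
rescaled to the required (mass, radius) — possible because the target radius/mass ratio `R₂A''/μ'` is
as large as we please for `μ'` small); globalise coordinates `S³ ∖ {Λ} ≅ E3` with `z ∝ w` on the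
floor ball, normalise the floor annulus to `{1 < ‖z‖ < 2}` by a homothety (`μ ∝ μ'`, small), read the
end in the isotropic chart at `Λ` (DR rates: `(1 + M/2r)⁴ = 1 + 2M/r + O(r⁻²)`, `k ≡ 0` — the sibling
crux 10055's `stub_isotropicEnd`), completeness from the compact bag + complete exact end, far-zone
co-compactness because the complement of a punctured neighbourhood of `Λ` in `S³ ∖ {Λ}` is compact.
(E-PLUG, fallback) the sibling crux 10055's `PlugData = stub_ttShellCap ∧ stub_massGluing` gives a
vacuum datum on `E3` exactly isotropic Schwarzschild(`M`) on `{ρ > ρ₃}`, `ρ₃ < M/2` (end, throat,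
collar; the TT-shell cap is the bag), whose cap interior `{ρ < 1}` is a nearly-flat time-symmetric
ball (`k = 0`, `φ_λ` harmonic `→ 1 + β`); insert the floor (small Schwarzschild(`μ`) body) there by
ONE no-KID local gluing (Hintz arXiv:2210.13960 Thm 1.1 — needs "no KIDs" of the cap interior, the
soft spot of that engine; PMT forbids an exactly flat collar, 10052 Disproof).
Why it might fail: E-BOM needs the quantitative Green's-function asymptotics along the critical path
(`A(s) → ∞` with `‖H‖_{C^k(B_{r₀/2})} ≲ A`, BOM (3.16)–(3.17)) in the form Corvino's smallness wants,
and Corvino's gluing run with the exact side INSIDE the annulus (same linearised cokernel and flux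
pairing, but not the printed configuration); E-PLUG needs a no-KID certificate. No obstruction of
Penrose/PMT type applies: the region outside the outermost minimal sphere IS Schwarzschild (Bray 2001 /
Huisken–Ilmanen equality case is respected, not violated), the floor collar is Schwarzschild(`μ > 0`)
not flat, and the bag is not spherically symmetric (no Birkhoff clash).
Leans on: `admissibleVacuumData E3`, `IsSchwarzschildAnnulus`, `IsThroatShieldedAway`,
`Schwarzschild.conformalData`, `AFEnd`/`IsStronglyAsymptoticallyFlatDR` (cf. `Schwarzschild.afEnd`,
`isAsymptoticallyFlat_timeSymmetricExteriorData`), `isComplete_of_isSoleEnd_holds`.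
[cite: BeigOmurchadha1991, (3.16)–(3.17)] [cite: Corvino2000, Thm 1, §4] [cite: ChruscielDelay2003, Thm 5.9, §8.9]
[cite: MisnerThorneWheeler1973, §31.7] [cite: Bray2001, §1] [cite: HuiskenIlmanen2001, §1]
[cite: BartnikIsenberg2004, §4] [cite: Hintz2022, Thm 1.1] [cite: LiMei2020, Thm 2.2] -/
def Sig.stub_bagDatum : Prop :=
  ∀ μ₀ : ℝ, 0 < μ₀ →
    ∃ μ : ℝ, 0 < μ ∧ μ ≤ μ₀ ∧
      ∃ C ∈ admissibleVacuumData E3, IsSchwarzschildAnnulus C μ ∧ IsThroatShieldedAway 2 C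

/-- **Stub C — `stub_splice` (dilate – transport – patch – breathe; size L; elementary but the
Lean-heaviest construction of the line; = 10052's `stub_splice` with the Kerr shield replaced by the
throat shield and no `[Kerr.Facts]`).** Data: an end `e` of `X`, a threshold `R⋆ > e.R`, rates
`0 < μ`, `32 μ ≤ η`, a smooth seed-mass function `m` and a radius-indexed family `G` as delivered by
Stub A for the datum `d`, and a bag datum `C` as delivered by Stub B (admissible on `E3`,
Schwarzschild(`μ`) on `{1 < ‖z‖ < 2}`, throat-shielded away from radius `2`). Conclusion: a
two-parameter family `S (R, t)` and a one-parameter comparison family `E t` of data on `X`, a point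
`x₀ ∉ e.far R⋆` and a vector `v₀` such that: `S` is jointly smooth on `{R⋆ < R} × ℝ × X`, `E` on
`ℝ × X`; `E 0 = d`; `S (R, t) = E t` (same sections) off `e.far R`; the MARKER
`t ↦ h_{E t}(x₀)(v₀, v₀)` is injective on `(−1, 1)`; and for `R > R⋆`, `|t| < 1` the member `S (R, t)`
is ADMISSIBLE and THROAT-SHIELDED.
Construction: `λ(R) := m R/μ ≥ 32 R` (smooth in `R`); on `{x ∈ e.U | λ < ‖chart x‖}` put the dilated
bag `Δ_λ^* C|_{1 < ‖z‖}` transported by `e.dataChart` (`Δ_λ x = x/λ`, data scaled by `(λ², λ)`: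
chart components `h_C(x/λ)`, `λ⁻¹ k_C(x/λ)` — in particular EXACT isotropic Schwarzschild(`λμ = m R`),
`k = 0`, on `{λ < ‖x‖ < 2λ} ⊆ {32R < ‖x‖}` where it coincides with `G R`); elsewhere put `G R`; the
two pieces agree on the open overlap, so the pointwise union is a smooth vacuum datum (`d`'s core now
sits on the FLOOR of the bag, behind the throat). Then pull back by the breathing diffeomorphisms
`Φ_{σ(t)}`, `Φ_s(x) = x₀ + (1 + s β(‖x − x₀‖))(x − x₀)` in the chart of `e` on a ball
`B ⊂ {e.R < ‖·‖ < R⋆}` (so `G R = d` on `B` for every `R > R⋆`); `E t := Φ_{σ(t)}^* d`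
(`InitialDataSet.comap`), marker `h_{E t}(x₀)(v₀,v₀) = (1 + σ t)² h_d(x₀)(v₀,v₀)`.
Admissibility of `S (R, t)`: constraints by `isVacuumConstraintSolution_comap` + scale covariance of
the constraints under `(h, k) ↦ (λ² Δ^*h, λ Δ^*k)`; completeness by patching two complete pieces; the
end: `e`'s chart composed with the dilation and the bag's own DR chart, DR rates by scaling, sole end
because `e` is sole for `X` and the bag's end is sole for `E3`. Throat-shieldedness with parameters
`(λM_C, λR₁^C)`: the shield of `C` sits in `{‖z‖ > 2}`, i.e. inside the pure-bag zone `{‖x‖ > 2λ}`;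
compose `Φ_C` with the dilation `throatRegion (λR₁) ≃ throatRegion R₁` and `e.dataChart` — the exact
clause holds because `λ² Δ_λ^* conformalData M = conformalData (λM)`
(`(1 + M/2‖y/λ‖)⁴ λ²·λ⁻² = (1 + λM/2‖y‖)⁴`, `k = 0`); the far-zone clause: the complement of the
transported far zone is `(X ∖ e.far ρ) ∪ e.dataChart(λ · (bounded closed set))`, compact by
`e.IsSoleEnd` (+ `far_mono`) and the far-zone clause of `IsThroatShieldedAway`. Joint smoothness in
`(R, t, x)`: `G` smooth in `(R, x)`, the transported bag smooth in `(R, x)` through `λ(R)`, `Φ` smooth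
in `(s, x)`.
Why it might fail: only through a typing mismatch of the chart conventions (`AFEnd.far`/`hCoeff` —
they do match: `far R = chart⁻¹{R < ‖·‖}`, `hCoeff` = pullback along `dataChart` for `‖x‖ > e.R`),
or if completeness of patched data needed more than the two pieces' completeness (it does not).
Leans on: `InitialDataSet.comap`, `comap_h_inner`, `comap_k`, `isVacuumConstraintSolution_comap`,
`comap_eq_self_of_eq_id` (InitialDataPullback.lean), `AFEnd.{dataChart, far, far_mono, isOpen_far,
isClosed_far, hCoeff_of_lt, kCoeff_of_lt}`, `Schwarzschild.conformalData_h_inner/_k`, `ContDiffBump`,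
`Real.smoothTransition`. [cite: Bartnik1986, §1] [cite: BartnikIsenberg2004, §2] -/
def Sig.stub_splice : Prop :=
  ∀ (X : Type) [TopologicalSpace X] [ChartedSpace E3 X] [IsManifold (𝓡 3) ∞ X]
    [T2Space X] [SecondCountableTopology X] [ConnectedSpace X]
    (d : InitialDataSet (𝓡 3) X) (e : AFEnd X) (Rstar η μ : ℝ) (m : ℝ → ℝ)
    (G : ℝ → InitialDataSet (𝓡 3) X) (C : InitialDataSet (𝓡 3) E3),
    e.IsSoleEnd → e.R < Rstar → 0 < μ → 32 * μ ≤ η → ContDiff ℝ ∞ m →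
    SmoothSectionsOn 𝓘(ℝ, ℝ) G {p : ℝ × X | Rstar < p.1} →
    (∀ R : ℝ, Rstar < R →
      G R ∈ admissibleVacuumData X ∧ (∀ x ∉ e.far R, AgreeAt (G R) d x) ∧
        η * R ≤ m R ∧ IsExactSchwarzschildBeyond e (G R) (m R) (32 * R)) →
    C ∈ admissibleVacuumData E3 → IsSchwarzschildAnnulus C μ → IsThroatShieldedAway 2 C →
    ∃ (S : ℝ × ℝ → InitialDataSet (𝓡 3) X) (E : ℝ → InitialDataSet (𝓡 3) X) (x₀ : X)
      (v₀ : TangentSpace (𝓡 3) x₀),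
      SmoothSectionsOn (𝓘(ℝ, ℝ).prod 𝓘(ℝ, ℝ)) S {p : (ℝ × ℝ) × X | Rstar < p.1.1} ∧
      SmoothSectionsOn 𝓘(ℝ, ℝ) E (Set.univ : Set (ℝ × X)) ∧
      E 0 = d ∧
      (∀ R t : ℝ, Rstar < R → ∀ x ∉ e.far R, AgreeAt (S (R, t)) (E t) x) ∧
      x₀ ∉ e.far Rstar ∧
      Set.InjOn (fun t : ℝ ↦ (E t).h.inner x₀ v₀ v₀) (Set.Ioo (-1) 1) ∧
      ∀ R t : ℝ, Rstar < R → |t| < 1 →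
        S (R, t) ∈ admissibleVacuumData X ∧ IsThroatShielded X (S (R, t))

/-! ## §2 The registered stubs (`sorry` lives only in these five theorems) -/

/-- **STUB T** (M–L; shared with cluster A): far-origin sojourn completeness transfers along an
embedded sub-development. -/
theorem stub_scriTransfer : Sig.stub_scriTransfer := by
  sorry

/-- **STUB S** (L; LOAD-BEARING for the idea): admissible throat-shielded data are scri-shielded —
the static chart / Kruskal region I certificate at `a = 0`. -/
theorem stub_throatShieldedScri : Sig.stub_throatShieldedScri := by
  sorry

/-- **STUB A** (XL; d-side; = 10052's registered `stub_farGluing` verbatim): receding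
obstruction-free gluing onto a growing exact isotropic Schwarzschild seed, smooth in the radius. -/
theorem stub_farGluing : Sig.stub_farGluing := by
  sorry

/-- **STUB B** (XL; HARDEST; d-free): ONE universal bag-of-gold datum on `ℝ³` — admissible,
time-symmetric, exact Schwarzschild(`μ`) floor annulus on `{1 < ‖z‖ < 2}`, throat-shielded beyond
radius `2` (engines E-BOM / E-PLUG). -/
theorem stub_bagDatum : Sig.stub_bagDatum := by
  sorry

/-- **STUB C** (L; elementary differential geometry on the fixed `X`): dilate–transport–patch the bag
onto the glued family along the common exact Schwarzschild(`m R`) annulus and breathe the core. -/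
theorem stub_splice : Sig.stub_splice := by
  sorry

/-! ## §3 The junction lemma — statement and PROOF

Verbatim from crux 10052's picked skeleton `receding-annulus-universal-collar` (planner seat
`cruxplan-stmt-FinalStateConjecture-10052-receding-annulus-uni`, kernel-checked there and re-checked
here): radius–breathing families reparametrise into a smooth injective one-parameter family through
`d`. It is engine-agnostic (no shield is mentioned), so it serves the throat line unchanged. -/

/-- **The JUNCTION LEMMA (proved below as `junction`): radius–breathing families reparametrise into a
smooth injective one-parameter family through `d`; pure differential topology.**  For any datum `d`,
end `e`, threshold `R⋆`, two-parameter family `S` smooth on `{R⋆ < R} × ℝ × X`, comparison family `E`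
smooth on `ℝ × X` with `E 0 = d`, `S (R, t) = E t` off `e.far R`, a point `x₀ ∉ e.far R⋆` and a vector
`v₀` whose marker `t ↦ h_{E t}(x₀)(v₀, v₀)` is injective on `(−1, 1)`: there is
`F : ℝ¹ → InitialDataSet (𝓡 3) X` with `IsSmoothDataFamily 1 F`, `F 0 = d`, `F` injective, and every
member `F c`, `c ≠ 0`, equal to some `S (R, t)` with `R > R⋆`, `|t| < 1`.
Proof: `F c := S (R⋆ + 1 + 1/‖c‖², θ c)` for `c ≠ 0`, `θ c := arctan (c 0)/2` (smooth, injective,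
`|θ| < π/4 < 1`), `F 0 := d`.  Smooth at `(c, x)`, `c ≠ 0`: composition of the joint smoothness of `S`
with the smooth map `(c, x) ↦ ((R c, θ c), x)` into `{R⋆ < R}`.  Smooth at `(0, x)`: LOCAL EXHAUSTION —
every `x` has a neighbourhood `V` and an `ε > 0` with `V ∩ e.far (R c) = ∅` for `‖c‖ < ε`, hence
`F c = E (θ c)` on `V` (sections), and `c ↦ E (θ c)` is a smooth family; conclude by the patching
principle of `SmoothDataFamilyLocal.lean` (the typed `IsSmoothDataFamily` is joint `ContMDiff` on
`ℝ¹ × X` and NOTHING ELSE — Genericity.lean:174, TRIAGE-r1-2 F3).  Injective: `x₀ ∉ e.far (R c)`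
(`far_mono`), so `h_{F c}(x₀)(v₀,v₀) = h_{E(θ c)}(x₀)(v₀,v₀)` for all `c`; marker injective on
`(−1,1) ∋ θ c` and `θ` injective give `c = c'`.  No mass is read anywhere, so the sign of `c` costs
nothing and ONE bag datum serves both signs (no "second background for `c < 0`", TRIAGE-r1-3 A4).
Leans on: `ContMDiffOn.comp/prodMk/congr`, `ContMDiffAt.congr_of_eventuallyEq`,
`AFEnd.{far_mono, isClosed_far}`, `Real.contDiff_arctan`, `Real.arctan_injective`, `contDiff_norm_sq`. -/
def JunctionLemma : Prop :=
  ∀ (X : Type) [TopologicalSpace X] [ChartedSpace E3 X] [IsManifold (𝓡 3) ∞ X]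
    [T2Space X] [SecondCountableTopology X] [ConnectedSpace X]
    (d : InitialDataSet (𝓡 3) X) (e : AFEnd X) (Rstar : ℝ)
    (S : ℝ × ℝ → InitialDataSet (𝓡 3) X) (E : ℝ → InitialDataSet (𝓡 3) X) (x₀ : X)
    (v₀ : TangentSpace (𝓡 3) x₀),
    SmoothSectionsOn (𝓘(ℝ, ℝ).prod 𝓘(ℝ, ℝ)) S {p : (ℝ × ℝ) × X | Rstar < p.1.1} →
    SmoothSectionsOn 𝓘(ℝ, ℝ) E (Set.univ : Set (ℝ × X)) →
    E 0 = d →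
    (∀ R t : ℝ, Rstar < R → ∀ x ∉ e.far R, AgreeAt (S (R, t)) (E t) x) →
    x₀ ∉ e.far Rstar →
    Set.InjOn (fun t : ℝ ↦ (E t).h.inner x₀ v₀ v₀) (Set.Ioo (-1) 1) →
    ∃ F : EuclideanSpace ℝ (Fin 1) → InitialDataSet (𝓡 3) X,
      InitialDataSet.IsSmoothDataFamily 1 F ∧ F 0 = d ∧ Function.Injective F ∧
      ∀ c ≠ 0, ∃ R t : ℝ, Rstar < R ∧ |t| < 1 ∧ F c = S (R, t)

/-! ## The junction lemma, PROVED (pure differential topology over `SmoothDataFamilyLocal.lean`) -/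

section Junction

variable {X : Type} [TopologicalSpace X] [ChartedSpace E3 X] [IsManifold (𝓡 3) ∞ X]

omit [IsManifold (𝓡 3) ∞ X] in
/-- LOCAL EXHAUSTION: the far regions of an end recede from every point — each `x : X` has a
neighbourhood missing `e.far ρ` for all large `ρ` (chart ball if `x ∈ e.U`; the complement of the
closed set `chart⁻¹{e.R + 1 ≤ ‖·‖}` otherwise, `AFEnd.isClosed_far`). [folklore] -/
theorem exists_nhds_forall_not_mem_far (e : AFEnd X) (x : X) :
    ∃ V ∈ 𝓝 x, ∃ ρ₀ : ℝ, ∀ ρ : ℝ, ρ₀ ≤ ρ → ∀ y ∈ V, y ∉ e.far ρ := by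
  by_cases hx : x ∈ (e.U : Set X)
  · refine ⟨((↑) : e.U → X) '' (e.chart ⁻¹' {z | ‖(z : E3)‖ < ‖(e.chart ⟨x, hx⟩ : E3)‖ + 1}), ?_,
      ‖(e.chart ⟨x, hx⟩ : E3)‖ + 1, ?_⟩
    · refine (e.U.isOpen.isOpenMap_subtype_val _ ?_).mem_nhds ⟨⟨x, hx⟩, by simp, rfl⟩
      exact (isOpen_lt continuous_subtype_val.norm continuous_const).preimage e.chart.continuous
    · rintro ρ hρ _ ⟨u, hu, rfl⟩ ⟨u', hu', huu'⟩
      obtain rfl : u' = u := Subtype.val_injective huu'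
      simp only [Set.mem_preimage, Set.mem_setOf_eq] at hu hu'
      linarith
  · refine ⟨(((↑) : e.U → X) '' (e.chart ⁻¹' {z | e.R + 1 ≤ ‖(z : E3)‖}))ᶜ, ?_, e.R + 1, ?_⟩
    · refine (e.isClosed_far (e.R + 1) (by linarith)).isOpen_compl.mem_nhds ?_
      rintro ⟨u, -, rfl⟩
      exact hx u.2
    · rintro ρ hρ y hy ⟨u, hu, rfl⟩
      exact hy ⟨u, le_of_lt (lt_of_le_of_lt hρ hu), rfl⟩

/-- The radius map `c ↦ R⋆ + 1 + ‖c‖⁻²` of the reparametrisation (junk at `c = 0`). -/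
def radiusOf (Rstar : ℝ) (c : EuclideanSpace ℝ (Fin 1)) : ℝ := Rstar + 1 + (‖c‖ ^ 2)⁻¹

/-- The breathing amplitude `c ↦ arctan(c₀)/2 ∈ (−π/4, π/4)` (smooth, injective, vanishing at `0`). -/
def angleOf (c : EuclideanSpace ℝ (Fin 1)) : ℝ := Real.arctan (c 0) / 2

theorem radiusOf_gt (Rstar : ℝ) (c : EuclideanSpace ℝ (Fin 1)) : Rstar < radiusOf Rstar c := by
  have : 0 ≤ (‖c‖ ^ 2)⁻¹ := inv_nonneg.2 (sq_nonneg _)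
  unfold radiusOf; linarith

theorem contDiffOn_radiusOf (Rstar : ℝ) :
    ContDiffOn ℝ ∞ (radiusOf Rstar) {c : EuclideanSpace ℝ (Fin 1) | c ≠ 0} := by
  refine contDiffOn_const.add ((contDiff_norm_sq ℝ).contDiffOn.inv fun c hc ↦ ?_)
  exact pow_ne_zero 2 (norm_ne_zero_iff.2 hc)

/-- Small nonzero parameters have large radius: `‖c‖ < min 1 ρ₃⁻¹`, `1 ≤ ρ₃` give `ρ₃ < ‖c‖⁻²`. -/
theorem lt_inv_norm_sq {c : EuclideanSpace ℝ (Fin 1)} (hc : c ≠ 0) {ρ₃ : ℝ} (hρ₃ : 1 ≤ ρ₃)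
    (h1 : ‖c‖ < 1) (h2 : ‖c‖ < ρ₃⁻¹) : ρ₃ < (‖c‖ ^ 2)⁻¹ := by
  have hcpos : 0 < ‖c‖ := norm_pos_iff.2 hc
  have hsq : ‖c‖ ^ 2 ≤ ‖c‖ := by nlinarith
  have hρ₃pos : 0 < ρ₃ := by linarith
  rw [lt_inv_comm₀ hρ₃pos (by positivity)]
  exact lt_of_le_of_lt hsq h2

theorem contDiff_angleOf : ContDiff ℝ ∞ angleOf := by
  unfold angleOf
  exact (Real.contDiff_arctan.comp (EuclideanSpace.proj (0 : Fin 1)).contDiff).div_const _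

theorem angleOf_zero : angleOf 0 = 0 := by simp [angleOf]

theorem angleOf_mem_Ioo (c : EuclideanSpace ℝ (Fin 1)) : angleOf c ∈ Set.Ioo (-1 : ℝ) 1 := by
  have h1 := Real.arctan_lt_pi_div_two (c 0)
  have h2 := Real.neg_pi_div_two_lt_arctan (c 0)
  have hπ := Real.pi_lt_four
  constructor <;> · unfold angleOf; linarith

theorem angleOf_injective : Function.Injective angleOf := by
  intro c c' h
  have h' : Real.arctan (c 0) = Real.arctan (c' 0) := by
    unfold angleOf at h; linarith
  have h0 : c 0 = c' 0 := Real.arctan_injective h'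
  ext i
  rw [Subsingleton.elim i 0]
  exact h0

open Classical in
/-- The reparametrised family: `F 0 = d`, `F c = S (R⋆ + 1 + ‖c‖⁻², arctan(c₀)/2)` for `c ≠ 0`. -/
def family (d : InitialDataSet (𝓡 3) X) (Rstar : ℝ) (S : ℝ × ℝ → InitialDataSet (𝓡 3) X)
    (c : EuclideanSpace ℝ (Fin 1)) : InitialDataSet (𝓡 3) X :=
  if c = 0 then d else S (radiusOf Rstar c, angleOf c)

theorem family_zero (d : InitialDataSet (𝓡 3) X) (Rstar : ℝ) (S : ℝ × ℝ → InitialDataSet (𝓡 3) X) :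
    family d Rstar S 0 = d := by
  simp [family]

theorem family_of_ne (d : InitialDataSet (𝓡 3) X) (Rstar : ℝ) (S : ℝ × ℝ → InitialDataSet (𝓡 3) X)
    {c : EuclideanSpace ℝ (Fin 1)} (hc : c ≠ 0) :
    family d Rstar S c = S (radiusOf Rstar c, angleOf c) := by
  simp [family, hc]

omit [IsManifold (𝓡 3) ∞ X] in
/-- The parameter map `(c, x) ↦ ((R c, θ c), x)` is smooth off `c = 0`. -/
theorem contMDiffOn_paramMap (Rstar : ℝ) :
    ContMDiffOn (𝓘(ℝ, EuclideanSpace ℝ (Fin 1)).prod (𝓡 3)) ((𝓘(ℝ, ℝ).prod 𝓘(ℝ, ℝ)).prod (𝓡 3)) ∞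
      (fun q : EuclideanSpace ℝ (Fin 1) × X ↦ ((radiusOf Rstar q.1, angleOf q.1), q.2))
      {q | q.1 ≠ 0} := by
  have hR : ContMDiffOn 𝓘(ℝ, EuclideanSpace ℝ (Fin 1)) 𝓘(ℝ, ℝ) ∞ (radiusOf Rstar) {c | c ≠ 0} :=
    (contDiffOn_radiusOf Rstar).contMDiffOn
  have hθ : ContMDiff 𝓘(ℝ, EuclideanSpace ℝ (Fin 1)) 𝓘(ℝ, ℝ) ∞ angleOf :=
    contDiff_angleOf.contMDiff
  exact ((hR.comp contMDiffOn_fst fun q hq ↦ hq).prodMk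
    (hθ.comp_contMDiffOn contMDiffOn_fst)).prodMk contMDiffOn_snd

omit [IsManifold (𝓡 3) ∞ X] in
/-- The comparison parameter map `(c, x) ↦ (θ c, x)` is smooth everywhere. -/
theorem contMDiff_compMap :
    ContMDiff (𝓘(ℝ, EuclideanSpace ℝ (Fin 1)).prod (𝓡 3)) (𝓘(ℝ, ℝ).prod (𝓡 3)) ∞
      (fun q : EuclideanSpace ℝ (Fin 1) × X ↦ (angleOf q.1, q.2)) :=
  (contDiff_angleOf.contMDiff.comp contMDiff_fst).prodMk contMDiff_snd

/-- Core of the junction lemma for ONE section selector `σ` (`σ D x = h_D(x)` or `k_D(x)`): the section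
`(c, x) ↦ σ (F c) x` of the reparametrised family is smooth — off `c = 0` by composition with the
parameter map, at `c = 0` by local exhaustion and eventual agreement with `(c, x) ↦ σ (E (θ c)) x`. -/
theorem contMDiff_family_section (d : InitialDataSet (𝓡 3) X) (e : AFEnd X) (Rstar : ℝ)
    (S : ℝ × ℝ → InitialDataSet (𝓡 3) X) (E : ℝ → InitialDataSet (𝓡 3) X)
    (σ : InitialDataSet (𝓡 3) X → (x : X) → (TangentSpace (𝓡 3) x →L[ℝ] TangentSpace (𝓡 3) x →L[ℝ] ℝ))
    (hS : ContMDiffOn ((𝓘(ℝ, ℝ).prod 𝓘(ℝ, ℝ)).prod (𝓡 3)) ((𝓡 3).prod 𝓘(ℝ, E3 →L[ℝ] E3 →L[ℝ] ℝ)) ∞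
      (fun p : (ℝ × ℝ) × X ↦
        TotalSpace.mk' (F := E3 →L[ℝ] E3 →L[ℝ] ℝ)
          (E := fun x : X ↦ TangentSpace (𝓡 3) x →L[ℝ] TangentSpace (𝓡 3) x →L[ℝ] ℝ) p.2
          (σ (S p.1) p.2)) {p | Rstar < p.1.1})
    (hE : ContMDiffOn (𝓘(ℝ, ℝ).prod (𝓡 3)) ((𝓡 3).prod 𝓘(ℝ, E3 →L[ℝ] E3 →L[ℝ] ℝ)) ∞
      (fun p : ℝ × X ↦
        TotalSpace.mk' (F := E3 →L[ℝ] E3 →L[ℝ] ℝ)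
          (E := fun x : X ↦ TangentSpace (𝓡 3) x →L[ℝ] TangentSpace (𝓡 3) x →L[ℝ] ℝ) p.2
          (σ (E p.1) p.2)) Set.univ)
    (hE0 : ∀ x, σ (E 0) x = σ d x)
    (hSE : ∀ R t : ℝ, Rstar < R → ∀ x ∉ e.far R, σ (S (R, t)) x = σ (E t) x) :
    ContMDiff (𝓘(ℝ, EuclideanSpace ℝ (Fin 1)).prod (𝓡 3)) ((𝓡 3).prod 𝓘(ℝ, E3 →L[ℝ] E3 →L[ℝ] ℝ)) ∞
      (fun q : EuclideanSpace ℝ (Fin 1) × X ↦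
        TotalSpace.mk' (F := E3 →L[ℝ] E3 →L[ℝ] ℝ)
          (E := fun x : X ↦ TangentSpace (𝓡 3) x →L[ℝ] TangentSpace (𝓡 3) x →L[ℝ] ℝ) q.2
          (σ (family d Rstar S q.1) q.2)) := by
  intro q
  obtain ⟨c, x⟩ := q
  by_cases hc : c = 0
  · -- at the junction: agree with the comparison family near `(0, x)`
    subst hc
    have hcomp : ContMDiff (𝓘(ℝ, EuclideanSpace ℝ (Fin 1)).prod (𝓡 3))
        ((𝓡 3).prod 𝓘(ℝ, E3 →L[ℝ] E3 →L[ℝ] ℝ)) ∞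
        (fun q : EuclideanSpace ℝ (Fin 1) × X ↦
          TotalSpace.mk' (F := E3 →L[ℝ] E3 →L[ℝ] ℝ)
            (E := fun x : X ↦ TangentSpace (𝓡 3) x →L[ℝ] TangentSpace (𝓡 3) x →L[ℝ] ℝ) q.2
            (σ (E (angleOf q.1)) q.2)) := by
      have := hE.comp contMDiff_compMap.contMDiffOn (fun q _ ↦ Set.mem_univ _) (s := Set.univ)
      exact contMDiffOn_univ.1 this
    apply (hcomp (0, x)).congr_of_eventuallyEq
    obtain ⟨V, hV, ρ₀, hVρ⟩ := exists_nhds_forall_not_mem_far e x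
    set ρ₃ : ℝ := max (ρ₀ - Rstar - 1) 1 with hρ₃
    have hρ₃1 : 1 ≤ ρ₃ := le_max_right _ _
    have hε : 0 < min 1 ρ₃⁻¹ := lt_min one_pos (inv_pos.2 (by linarith))
    have hN : Metric.ball (0 : EuclideanSpace ℝ (Fin 1)) (min 1 ρ₃⁻¹) ×ˢ V ∈
        𝓝 ((0 : EuclideanSpace ℝ (Fin 1)), x) :=
      prod_mem_nhds (Metric.ball_mem_nhds _ hε) hV
    filter_upwards [hN] with q hq
    obtain ⟨hq1, hq2⟩ := hq
    rw [Metric.mem_ball, dist_zero_right] at hq1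
    by_cases hq0 : q.1 = 0
    · simp only [hq0, family_zero, angleOf_zero, hE0]
    · have hfar : q.2 ∉ e.far (radiusOf Rstar q.1) := by
        refine hVρ _ ?_ _ hq2
        have := lt_inv_norm_sq hq0 hρ₃1 (lt_of_lt_of_le hq1 (min_le_left _ _))
          (lt_of_lt_of_le hq1 (min_le_right _ _))
        have h' : ρ₀ - Rstar - 1 ≤ ρ₃ := le_max_left _ _
        unfold radiusOf; linarith
      simp only [family_of_ne _ _ _ hq0, hSE _ _ (radiusOf_gt Rstar q.1) _ hfar]
  · -- off the junction: composition with the parameter map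
    have hopen : IsOpen {q : EuclideanSpace ℝ (Fin 1) × X | q.1 ≠ 0} :=
      isOpen_ne.preimage continuous_fst
    have hcomp := hS.comp (contMDiffOn_paramMap (X := X) Rstar) (fun q _ ↦ radiusOf_gt Rstar q.1)
    have hcongr : ContMDiffOn (𝓘(ℝ, EuclideanSpace ℝ (Fin 1)).prod (𝓡 3))
        ((𝓡 3).prod 𝓘(ℝ, E3 →L[ℝ] E3 →L[ℝ] ℝ)) ∞
        (fun q : EuclideanSpace ℝ (Fin 1) × X ↦
          TotalSpace.mk' (F := E3 →L[ℝ] E3 →L[ℝ] ℝ)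
            (E := fun x : X ↦ TangentSpace (𝓡 3) x →L[ℝ] TangentSpace (𝓡 3) x →L[ℝ] ℝ) q.2
            (σ (family d Rstar S q.1) q.2)) {q | q.1 ≠ 0} := by
      refine hcomp.congr fun q hq ↦ ?_
      simp only [Function.comp_apply, family_of_ne _ _ _ hq]
    exact hcongr.contMDiffAt (hopen.mem_nhds hc)

/-- **The junction lemma, proved.** -/
theorem junction : JunctionLemma := by
  intro X _ _ _ _ _ _ d e Rstar S E x₀ v₀ hS hE hE0 hSE hx₀ hmark
  refine ⟨family d Rstar S, ?_, family_zero d Rstar S, ?_, fun c hc ↦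
    ⟨radiusOf Rstar c, angleOf c, radiusOf_gt Rstar c, abs_lt.2 (angleOf_mem_Ioo c),
      family_of_ne d Rstar S hc⟩⟩
  · -- smooth family: both sections, by the one-selector core lemma
    refine ⟨contMDiff_family_section d e Rstar S E (fun D x ↦ D.h.inner x) hS.1 hE.1
        (fun x ↦ by rw [hE0]) (fun R t hR x hx ↦ (hSE R t hR x hx).1), ?_⟩
    exact contMDiff_family_section d e Rstar S E (fun D x ↦ D.k x) hS.2 hE.2
        (fun x ↦ by rw [hE0]) (fun R t hR x hx ↦ (hSE R t hR x hx).2)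
  · -- injective: read the marker at `x₀`
    intro c c' hcc'
    have hread : ∀ c : EuclideanSpace ℝ (Fin 1),
        (family d Rstar S c).h.inner x₀ v₀ v₀ = (E (angleOf c)).h.inner x₀ v₀ v₀ := by
      intro c
      by_cases hc : c = 0
      · subst hc
        rw [family_zero, angleOf_zero, hE0]
      · have hfar : x₀ ∉ e.far (radiusOf Rstar c) :=
          fun h ↦ hx₀ (e.far_mono (le_of_lt (radiusOf_gt Rstar c)) h)
        rw [family_of_ne d Rstar S hc, (hSE _ _ (radiusOf_gt Rstar c) x₀ hfar).1]
    have hm : (E (angleOf c)).h.inner x₀ v₀ v₀ = (E (angleOf c')).h.inner x₀ v₀ v₀ := by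
      rw [← hread c, ← hread c', hcc']
    exact angleOf_injective (hmark (angleOf_mem_Ioo c) (angleOf_mem_Ioo c') hm)

end Junction

/-! ## §4 The compositions: the stubs conclude the crux BY NAME (real proofs, no `sorry`) -/

/-- **`ThroatBurial` from the three engine stubs** (mirror image of 10052's `ParametricKerrBurial_of`).
Given `X` and an admissible `d`: Stub A gives the rate `η`, the sole end `e`, the threshold `R⋆`, the
seed masses `m` and the glued family `G`; Stub B at `μ₀ := η/32` gives `μ ≤ η/32` and the bag `C`;
Stub C splices them into `S`, `E`, `x₀`, `v₀`; the proved junction lemma reparametrises into the smooth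
injective family `F` through `d`; every member `F c`, `c ≠ 0`, is some `S (R, t)` with `R > R⋆`,
`|t| < 1`, hence admissible and throat-shielded (Stub C), and `F 0 = d` is admissible by hypothesis. -/
theorem throatBurial_of :
    Sig.stub_farGluing → Sig.stub_bagDatum → Sig.stub_splice → ThroatBurial := by
  intro hA hB hC X _ _ _ _ _ _ d hd
  have hD : JunctionLemma := junction
  obtain ⟨η, e, Rstar, m, G, hη, hsole, heR, hm, hGs, hG⟩ := hA X d hd
  obtain ⟨μ, hμ, hμle, C, hCadm, hCann, hCsh⟩ := hB (η / 32) (by positivity)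
  have h32 : 32 * μ ≤ η := by linarith
  obtain ⟨S, E, x₀, v₀, hSs, hEs, hE0, hSE, hx₀, hmark, hgood⟩ :=
    hC X d e Rstar η μ m G C hsole heR hμ h32 hm hGs hG hCadm hCann hCsh
  obtain ⟨F, hF, hF0, hFinj, hmem⟩ := hD X d e Rstar S E x₀ v₀ hSs hEs hE0 hSE hx₀ hmark
  refine ⟨F, hF, hF0, hFinj, fun c ↦ ?_, fun c hc ↦ ?_⟩
  · by_cases hc : c = 0
    · subst hc
      rw [hF0]
      exact hd
    · obtain ⟨R, t, hR, ht, hFc⟩ := hmem c hc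
      rw [hFc]
      exact (hgood R t hR ht).1
  · obtain ⟨R, t, hR, ht, hFc⟩ := hmem c hc
    rw [hFc]
    exact (hgood R t hR ht).2

/-- The engine instantiated: `ThroatBurial` from the three registered engine stubs (sorried through them
only; concludes the intermediate notion, not the crux). -/
theorem throatBurial_skeleton : ThroatBurial :=
  throatBurial_of stub_farGluing stub_bagDatum stub_splice

/-- **Scri-shielded data are censored in every MGHD** (pure logic from the two soft inputs):
`SubdataDevelopmentsEmbed` (item 10053) supplies the embedding `χ` of the certifying development `𝒦`
into any MAXIMAL `𝒟`, and the transfer stub moves sojourn completeness along it. Maximality of `𝒟` is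
consumed here and only here (Disproof §4(c)/§8 honoured). -/
theorem hasCompleteNullInfinity_of_isScriShielded (hE : SubdataDevelopmentsEmbed)
    (hT : Sig.stub_scriTransfer) (X : Type) [TopologicalSpace X] [ChartedSpace E3 X]
    [IsManifold (𝓡 3) ∞ X] [T2Space X] [SecondCountableTopology X] [ConnectedSpace X]
    (D : InitialDataSet (𝓡 3) X) (hS : IsScriShielded X D)
    (𝒟 : VacuumCauchyDevelopment D) (hmax : 𝒟.IsMaximal) :
    Summit.FinalStateConjecture.HasCompleteNullInfinity 𝒟.toCauchyDevelopment := by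
  obtain ⟨N, _, _, _, _, Φ, hΦ, hΦ', hopen, 𝒦, A, K, hK, hKA, hfar⟩ := hS
  obtain ⟨χ, hχ, hχo, hiso, hτ, hcomm⟩ := hE X D 𝒟 hmax N Φ hΦ hΦ' hopen 𝒦
  exact hT X D 𝒟.toCauchyDevelopment N Φ hΦ hΦ' hopen 𝒦.toDataEmbedding χ hχ hχo hiso hτ hcomm
    A K hK hKA hfar

/-- **THE SKELETON THEOREM — the five stub statements (+ the registered route items 9937 and 10053,
BY NAME) conclude the crux BY NAME** (pure logic: `throatBurial_of`, unfolding of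
`IsChristodoulouGeneric … 1`, MGHD existence on the admissible members, the certificate on the members
off `c = 0`, and `hasCompleteNullInfinity_of_isScriShielded`; this is the ONLY declaration of the file
whose conclusion is the crux decl, so the skeleton audit is unambiguous):
`MGHDExists → SubdataDevelopmentsEmbed → Sig.stub_scriTransfer → Sig.stub_throatShieldedScri →
Sig.stub_farGluing → Sig.stub_bagDatum → Sig.stub_splice → WeakCosmicCensorshipMGHD`. -/
theorem WeakCosmicCensorshipMGHD_of :
    MGHDExists → SubdataDevelopmentsEmbed → Sig.stub_scriTransfer → Sig.stub_throatShieldedScri →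
      Sig.stub_farGluing → Sig.stub_bagDatum → Sig.stub_splice →
        Summit.FinalStateConjecture.FinalStateConjecture.Theses.PhaseMixingCapture.WeakCosmicCensorshipMGHD := by
  intro hM hE hT hS hA hB hC X _ _ _ _ _ _ d hd
  have hBur : ThroatBurial := throatBurial_of hA hB hC
  obtain ⟨F, h1, h2, h3, h4, h5⟩ := hBur X d hd.1
  refine ⟨F, h1, h2, h3, h4, fun c hc hmem ↦ hmem.2 ⟨hM X (F c) (h4 c), fun 𝒟 hmax ↦ ?_⟩⟩
  exact hasCompleteNullInfinity_of_isScriShielded hE hT X (F c) (hS X (F c) (h4 c) (h5 c hc)) 𝒟 hmax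

/-- The skeleton instantiated (an `example`, so it registers nothing and leaves `WeakCosmicCensorshipMGHD_of`
the unique crux-concluding declaration): the crux from the five registered stubs, sorried through them
only, with the two registered route items as hypotheses. -/
example (hM : MGHDExists) (hE : SubdataDevelopmentsEmbed) :
    Summit.FinalStateConjecture.FinalStateConjecture.Theses.PhaseMixingCapture.WeakCosmicCensorshipMGHD :=
  WeakCosmicCensorshipMGHD_of hM hE stub_scriTransfer stub_throatShieldedScri stub_farGluing
    stub_bagDatum stub_splice

/-! ## §5 Sanity and negative-side checks (all proved) -/

/-- **Necessity, per carrier** (`FinalStateConjecture →` the crux's property on each `X`; monotonicity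
of Christodoulou genericity in the property, = Disproof §1 `isChristodoulouGeneric_wccSet_of_summit`):
the crux is NECESSARY for the summit, so no transfer/strengthening of this line weakens it. Stated per
`X` (not with the route decl as conclusion) so that `WeakCosmicCensorshipMGHD_of` stays the unique
crux-concluding declaration. -/
theorem wccAt_of_finalStateConjecture (h : FinalStateConjecture) (X : Type) [TopologicalSpace X]
    [ChartedSpace E3 X] [IsManifold (𝓡 3) ∞ X] [T2Space X] [SecondCountableTopology X]
    [ConnectedSpace X] :
    InitialDataSet.IsChristodoulouGeneric (admissibleVacuumData X)
      (fun D ↦ (∃ 𝒟 : VacuumCauchyDevelopment D, 𝒟.IsMaximal) ∧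
        ∀ 𝒟 : VacuumCauchyDevelopment D, 𝒟.IsMaximal →
          Summit.FinalStateConjecture.HasCompleteNullInfinity 𝒟.toCauchyDevelopment) 1 := by
  intro d hd
  obtain ⟨F, h1, h2, h3, h4, h5⟩ := h X d ⟨hd.1, fun hP ↦ hd.2 ⟨hP.1, fun 𝒟 hm ↦ (hP.2 𝒟 hm).1⟩⟩
  exact ⟨F, h1, h2, h3, h4, fun c hc hmem ↦
    h5 c hc ⟨hmem.1, fun hP ↦ hmem.2 ⟨hP.1, fun 𝒟 hm ↦ (hP.2 𝒟 hm).1⟩⟩⟩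

/-- **Negative check (content of the landed `Negative/LoadBearing.isEmpty_vacuumCauchyDevelopment_of_not_t2Space`,
re-proved here because that module is not yet built on the farm):** the `[T2Space X]` binder kept in
every def above is load-bearing — a data embedding into a (Hausdorff) spacetime forces the carrier to
be Hausdorff, so on a non-Hausdorff carrier no datum has any vacuum Cauchy development. The companion
landed lemma `Negative/TruncatedMinkowski.exists_vacuumCauchyDevelopment_trivialData_not_complete`
(some vacuum Cauchy development of the trivial datum has INCOMPLETE `𝓘⁺`) is why every certificate of
this file is an `∃`-over-developments statement moved only into MAXIMAL targets. -/
theorem negative_check_t2 {X : Type} [TopologicalSpace X] [ChartedSpace E3 X]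
    [IsManifold (𝓡 3) ∞ X] [ConnectedSpace X] (hX : ¬ T2Space X) (D : InitialDataSet (𝓡 3) X) :
    IsEmpty (VacuumCauchyDevelopment D) :=
  ⟨fun 𝒟 ↦ hX 𝒟.toDataEmbedding.isSmoothEmbedding.isEmbedding.t2Space⟩

end Summit.FinalStateConjecture.FinalStateConjecture.Cruxes.WeakCosmicCensorshipMGHD.ThroatIsTheJunction

end
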